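import Literature.NumberTheory.EllipticCurves.ModularFormsGamma0Dimension
import HarnessLib

/-!
# The lower bound `12 dim S_k(Γ₀(N)) ≥ (k-1)μ - 6ν_∞ + 3ν₂ε₄(k) + 4ν₃ε₆(k)` in **every** even
# weight (Diamond–Shurman Thm. 3.5.1, existence half, all `k`)

`ModularFormsGamma0Dimension` derives from the level-one basis of `M(Γ₀(N))` over `ℂ[E₄, E₆]`
(Gannon's constraints, `ModularFormsGamma0FreeModule/Rank/Genus`) the exact dimension formula
`12 dim M_k(Γ₀(N)) = (k-1)μ + 6ν_∞ + 3ν₂ε₄(k) + 4ν₃ε₆(k)` for even `k ≥ max_j k_j` (stated for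
`k ≥ 6μ`), because the per-generator identity `12 dim R_w + 6[4 ∤ w] + 8[w ≡ 2 (6)] + 4[w ≡ 4 (6)]
= w + 12` (`R_w = M_w(SL₂(ℤ))`) needs `w = k - k_j ≥ 0`. For `w < 0` even one has `dim R_w = 0` and
the identity becomes the **inequality** `w + 12 ≤ 6[4 ∤ w] + 8[w ≡ 2 (6)] + 4[w ≡ 4 (6)]`
(`twelve_mul_finrank_levelOneSpace_ge`: the right-hand side is `0, 12, 6, 4, 14, 0, …` at
`w = -2, -4, …`, never below `w + 12`). Summing over the generators exactly as there gives, for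
**all even `k`**,

  `12 dim M_k(Γ₀(N)) ≥ (k-1)μ + 6ν_∞ + 3ν₂ε₄(k) + 4ν₃ε₆(k)`   (`twelve_mul_finrank_gamma0Space_ge`),

and with `dim M_k ≤ dim S_k + ν_∞` (`finrank_gamma0Space_le_finrank_cuspForm_add`, any weight)

  `12 dim S_k(Γ₀(N)) ≥ (k-1)μ - 6ν_∞ + 3ν₂ε₄(k) + 4ν₃ε₆(k)`   (`le_twelve_mul_finrank_cuspForm_gamma0_of_even`),
  `dim S_k(Γ₀(N)) ≥ (k-1)(g-1) + ⌊k/4⌋ν₂ + ⌊k/3⌋ν₃ + (k/2 - 1)ν_∞`   (`le_finrank_cuspForm_gamma0_of_even`)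

— the existence half of Diamond–Shurman Thm. 3.5.1 in every even weight `k ≥ 0` (for `k ≥ 4` the
right-hand side is the exact dimension; the matching upper bound is the rank half of
Eichler–Shimura / Riemann–Roch). This is the dimension input `d* ≤ dim S_k` of the rank bound for
the weight-`k` Eichler–Shimura period lattice of `Γ₀(N)` (Shimura 1971, (3.5.20)).

Everything is proved; there are no named facts and no new definitions.

## References

* F. Diamond, J. Shurman, *A first course in modular forms*, GTM 228, Springer (2005), Thm. 3.5.1.
* T. Gannon, *The theory of vector-valued modular forms for the modular group*, Contrib. Math.
  Comput. Sci. 8 (2014), 247–286, Thm. 3.4 and §3.5.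
* G. Shimura, *Introduction to the arithmetic theory of automorphic functions* (1971), Thm. 2.23,
  (3.5.20).
-/

noncomputable section

open UpperHalfPlane hiding I
open ModularForm Complex Matrix.SpecialLinearGroup Filter Asymptotics CongruenceSubgroup
open EisensteinSeries ModularGroup
open scoped MatrixGroups Real ModularForm Topology Manifold

namespace Literature.NumberTheory.EllipticCurves.ModularForms

/-! ### Level one: the per-weight inequality in every even weight -/

section LevelOne

/-- `dim M_w(SL₂(ℤ)) = 0` for `w < 0`. [folklore] -/
theorem finrank_levelOneSpace_of_neg {w : ℤ} (hw : w < 0) :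
    Module.finrank ℂ (levelOneSpace w) = 0 := by
  rw [finrank_formSpace]
  exact Module.finrank_eq_of_rank_eq (by rw [ModularForm.levelOne_neg_weight_rank_zero hw]; simp)

/-- **The per-weight inequality in every even weight `w`**:
`w + 12 ≤ 12 dim R_w + 6[4 ∤ w] + 8[w ≡ 2 (6)] + 4[w ≡ 4 (6)]` — an equality for `w ≥ 0`
(`twelve_mul_finrank_levelOneSpace`), and for `w < 0`, where `dim R_w = 0`, the right-hand side is
`≥ w + 12` by inspection of `w = -2, …, -10` (and trivially for `w ≤ -12`). [folklore] -/
theorem twelve_mul_finrank_levelOneSpace_ge {w : ℤ} (he : Even w) :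
    w + 12 ≤ 12 * (Module.finrank ℂ (levelOneSpace w) : ℤ) +
      6 * (if ¬ (4 : ℤ) ∣ w then (1 : ℤ) else 0) +
        8 * (if w % 6 = 2 then (1 : ℤ) else 0) + 4 * (if w % 6 = 4 then (1 : ℤ) else 0) := by
  rcases lt_or_ge w 0 with hneg | hnn
  · rw [finrank_levelOneSpace_of_neg hneg]
    obtain ⟨b, hb⟩ := he
    split_ifs <;> push_cast <;> omega
  · rw [twelve_mul_finrank_levelOneSpace hnn he]

end LevelOne

/-! ### `12 dim M_k(Γ₀(N)) ≥ (k-1)μ + 6ν_∞ + 3ν₂ε₄(k) + 4ν₃ε₆(k)` for every even `k` -/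

section Dimension

variable {N : ℕ} [NeZero N]
variable {wt : Fin (gamma0Index N) → ℤ} {F : Fin (gamma0Index N) → ℍ → ℂ}

/-- **The dimension inequality for `M_k(Γ₀(N))` from a level-one basis**, every even `k`:
`(k-1)μ + 6ν_∞ + 3ν₂ε₄(k) + 4ν₃ε₆(k) ≤ 12 dim M_k(Γ₀(N))` (sum the per-weight inequality over
`w = k - k_j` and insert `∑ k_j + 6ν_∞ = 6μ` and the two elliptic counts, as in
`twelve_mul_finrank_gamma0Space`). [cite: DiamondShurman2005, Thm. 3.5.1] -/
theorem twelve_mul_finrank_gamma0Space_ge (hb : IsLevelOneBasis N wt F)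
    (hwt : ∀ j, 0 ≤ wt j ∧ Even (wt j)) {k : ℤ} (hk : Even k) :
    (k - 1) * gamma0Index N + 6 * nuInfty N + 3 * nu₂ N * eps4 k + 4 * nu₃ N * eps6 k ≤
      12 * (Module.finrank ℂ (gamma0Space N k) : ℤ) := by
  classical
  have hK := totalWeight_eq hb hwt
  have h4 := two_mul_card_not_four_dvd_sub hb hwt hk
  have h6 := three_mul_card_sub_mod_six hb hwt hk
  -- sum the per-weight inequality
  have hsum := Finset.sum_le_sum
    fun j (_ : j ∈ (Finset.univ : Finset (Fin (gamma0Index N)))) ↦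
      twelve_mul_finrank_levelOneSpace_ge (w := k - wt j) (hk.sub (hwt j).2)
  simp only [Finset.sum_add_distrib, ← Finset.mul_sum, Finset.sum_boole, Finset.sum_sub_distrib,
    Finset.sum_const, Finset.card_univ, Fintype.card_fin, nsmul_eq_mul] at hsum
  rw [hb.finrank_eq k]
  push_cast
  unfold totalWeight at hK
  nlinarith [hsum, hK, h4, h6]

variable (N)

/-- **`12 dim M_k(Γ₀(N)) ≥ (k-1)μ + 6ν_∞ + 3ν₂ε₄(k) + 4ν₃ε₆(k)` for every even `k`.**
[cite: DiamondShurman2005, Thm. 3.5.1] -/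
theorem twelve_mul_finrank_modularForm_gamma0_ge {k : ℤ} (hk : Even k) :
    (k - 1) * gamma0Index N + 6 * nuInfty N + 3 * nu₂ N * eps4 k + 4 * nu₃ N * eps6 k ≤
      12 * (Module.finrank ℂ (ModularForm (Gamma0 N) k) : ℤ) := by
  obtain ⟨wt, F, hb, hwt⟩ := exists_isLevelOneBasis_card_eq N
  rw [← finrank_formSpace]
  exact twelve_mul_finrank_gamma0Space_ge hb hwt hk

end Dimension

/-! ### Assembly: the lower bound for `dim S_k(Γ₀(N))`, every even `k` -/

section Assembly

variable (N : ℕ) [NeZero N]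

/-- **`12 dim S_k(Γ₀(N)) ≥ (k-1)μ - 6ν_∞ + 3ν₂ε₄(k) + 4ν₃ε₆(k)` for every even `k`** — the
existence half of Diamond–Shurman Thm. 3.5.1 (`dim S_k = dim M_k - ν_∞` for `k ≥ 4`), by the
free-module route. [cite: DiamondShurman2005, Thm. 3.5.1] -/
theorem le_twelve_mul_finrank_cuspForm_gamma0_of_even {k : ℤ} (hk : Even k) :
    (k - 1) * gamma0Index N - 6 * nuInfty N + 3 * nu₂ N * eps4 k + 4 * nu₃ N * eps6 k ≤
      12 * (Module.finrank ℂ (CuspForm (Gamma0 N) k) : ℤ) := by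
  have h1 := twelve_mul_finrank_modularForm_gamma0_ge N hk
  have h2 := finrank_gamma0Space_le_finrank_cuspForm_add N k
  rw [finrank_formSpace] at h2
  have h2' : (Module.finrank ℂ (ModularForm (Gamma0 N) k) : ℤ) ≤
      Module.finrank ℂ (CuspForm (Gamma0 N) k) + nuInfty N := by exact_mod_cast h2
  linarith

/-- **`dim S_k(Γ₀(N)) ≥ (k-1)(g-1) + ⌊k/4⌋ν₂ + ⌊k/3⌋ν₃ + (k/2 - 1)ν_∞` for every even `k`**
(Diamond–Shurman Thm. 3.5.1, existence half; for `k ≥ 4` the right-hand side is the exact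
dimension). [cite: DiamondShurman2005, Thm. 3.5.1] -/
theorem le_finrank_cuspForm_gamma0_of_even {k : ℕ} (hk : Even k) :
    ((k : ℤ) - 1) * ((genusX0 N : ℤ) - 1) + (k / 4 : ℕ) * nu₂ N + (k / 3 : ℕ) * nu₃ N +
        ((k / 2 : ℕ) - 1 : ℤ) * nuInfty N ≤
      Module.finrank ℂ (CuspForm (Gamma0 N) k) := by
  have h := le_twelve_mul_finrank_cuspForm_gamma0_of_even N (k := k) (by exact_mod_cast hk)
  have hg := twelve_mul_genusX0_holds N
  unfold twelve_mul_genusX0 at hg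
  have hg' : (12 * genusX0 N + 3 * nu₂ N + 4 * nu₃ N + 6 * nuInfty N : ℤ) = 12 + gamma0Index N := by
    exact_mod_cast hg
  have hk2 := Nat.even_iff.mp hk
  have hA : (12 * (k / 4 : ℕ) : ℤ) = 3 * k - 3 + 3 * eps4 k := by
    unfold eps4; split_ifs <;> push_cast <;> omega
  have hB : (12 * (k / 3 : ℕ) : ℤ) = 4 * k - 4 + 4 * eps6 k := by
    unfold eps6; split_ifs <;> push_cast <;> omega
  have hC : (12 * (k / 2 : ℕ) : ℤ) = 6 * k := by push_cast; omega
  have key : 12 * (((k : ℤ) - 1) * ((genusX0 N : ℤ) - 1) + (k / 4 : ℕ) * nu₂ N +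
        (k / 3 : ℕ) * nu₃ N + ((k / 2 : ℕ) - 1 : ℤ) * nuInfty N) =
      ((k : ℤ) - 1) * gamma0Index N - 6 * nuInfty N + 3 * nu₂ N * eps4 k + 4 * nu₃ N * eps6 k := by
    linear_combination ((k : ℤ) - 1) * hg' + (nu₂ N : ℤ) * hA + (nu₃ N : ℤ) * hB +
      (nuInfty N : ℤ) * hC
  linarith

end Assembly

end Literature.NumberTheory.EllipticCurves.ModularForms
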